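/- LEAD seat `ym-line-cbag-p1` (prover-ym-line-cbag-p1-g24-0), route `EguchiKawaiDirectionLadder` (ideator ym-idea-2, LINE 8),
crux K_A `TripleSmallBallMargin` (stmt-QuantumFields-27724), S10-C ingredient (LEAD): the OFF-BLOCK EVENT `A` of the decoupling
(blockwise: every labelled off-diagonal block of `X` has Frobenius mass `≤ b`) and its Haar bound through width seat w3's
off-diagonal-block small-ball theorem `HaarColumns.haar_offDiagBlockSq_smallBall` (`A ⊆ {offDiagBlockSq ≤ m²b}`), with the
dictionary between the total labelling `ℓ : Fin N → Fin (m+1)` (collar = `Fin.last m`) used by w4's block calculus and the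
`Option (Fin m)` labelling used by w3's theorem.  ROUTE-INDEPENDENT.  Nothing here bears on the Yang–Mills mass gap. -/
import Summits.QuantumFields.YangMills.Theorems.EguchiKawaiDirectionLadderHaarOffDiagSmallBall
import Summits.QuantumFields.YangMills.Theorems.EguchiKawaiDirectionLadderBlockDiagonalDefs
import HarnessLib

/-!
# Route `EguchiKawaiDirectionLadder`, crux `TripleSmallBallMargin`: the off-block event and its Haar bound (S10-C)

* `toOptionLabel ℓ` — `Fin (m+1)`-labels to `Option (Fin m)`-labels (`last ↦ none`, `castSucc a ↦ some a`), `toOptionLabel_eq_some_iff`;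
* `offBlockEvent ℓ b = {X : ∀ a ≠ a′, Σ|X.toBlock (ℓ = castSucc a) (ℓ = castSucc a′)|² ≤ b}`;
* `offDiagBlockSq_le_of_mem_offBlockEvent` — on `offBlockEvent ℓ b`: `offDiagBlockSq (toOptionLabel ℓ) X ≤ m·m·b`;
* `haar_offBlockEvent_le` — `Haar(offBlockEvent ℓ b) ≤ exp(C_m N²) · (m²b/N)^{labelPairCount (toOptionLabel ℓ)/2}` for `0 < m²b/N ≤ 1`.
-/

set_option autoImplicit false

noncomputable section

open MeasureTheory
open scoped ENNReal
open Literature.Barriers.QuantumFields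

namespace Summit.QuantumFields.YangMills.Theorems.EguchiKawaiDirectionLadder

open Literature.MathematicalPhysics.QuantumFieldTheory (haarProbability)

variable {N m : ℕ}

/-- `Fin (m+1)`-labels (collar = `Fin.last m`) as `Option (Fin m)`-labels (collar = `none`). -/
def toOptionLabel (ℓ : Fin N → Fin (m + 1)) (i : Fin N) : Option (Fin m) :=
  if h : ℓ i = Fin.last m then none else some ((ℓ i).castPred h)

/-- `toOptionLabel ℓ i = some a ↔ ℓ i = a.castSucc`. -/
theorem toOptionLabel_eq_some_iff (ℓ : Fin N → Fin (m + 1)) (i : Fin N) (a : Fin m) :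
    toOptionLabel ℓ i = some a ↔ ℓ i = a.castSucc := by
  unfold toOptionLabel
  split_ifs with h
  · simp only [false_iff]
    rw [h]; exact (Fin.castSucc_lt_last a).ne'
  · simp only [Option.some.injEq]
    constructor
    · intro h'; rw [← h', Fin.castSucc_castPred]
    · intro h'; exact Fin.ext (by rw [Fin.coe_castPred, h', Fin.val_castSucc])

/-- `toOptionLabel ℓ i = none ↔ ℓ i = Fin.last m`. -/
theorem toOptionLabel_eq_none_iff (ℓ : Fin N → Fin (m + 1)) (i : Fin N) :
    toOptionLabel ℓ i = none ↔ ℓ i = Fin.last m := by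
  unfold toOptionLabel
  split_ifs with h
  · simp [h]
  · simp [h]

/-- **The off-block event**: every labelled off-diagonal block has Frobenius mass `≤ b`. -/
def offBlockEvent (ℓ : Fin N → Fin (m + 1)) (b : ℝ) : Set (UN N) :=
  {X : UN N | ∀ a a' : Fin m, a ≠ a' →
    ∑ i : {i // ℓ i = a.castSucc}, ∑ j : {j // ℓ j = a'.castSucc},
      ‖(X : Matrix (Fin N) (Fin N) ℂ).toBlock (fun i => ℓ i = a.castSucc) (fun j => ℓ j = a'.castSucc) i j‖ ^ 2 ≤ b}

/-- The entrywise indicator of w3's `offDiagBlockSq` splits over ordered label pairs `(a, a′)`, `a ≠ a′`. -/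
theorem offDiag_indicator_eq_sum (ℓ : Fin N → Fin (m + 1)) (X : Matrix (Fin N) (Fin N) ℂ) (j k : Fin N) :
    (if toOptionLabel ℓ j ≠ toOptionLabel ℓ k ∧ toOptionLabel ℓ j ≠ none ∧ toOptionLabel ℓ k ≠ none then ‖X j k‖ ^ 2 else 0) =
      ∑ a : Fin m, ∑ a' : Fin m,
        (if ℓ j = a.castSucc ∧ ℓ k = a'.castSucc ∧ a ≠ a' then ‖X j k‖ ^ 2 else 0) := by
  classical
  by_cases hj : ℓ j = Fin.last m
  · have hjn : toOptionLabel ℓ j = none := (toOptionLabel_eq_none_iff ℓ j).2 hj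
    rw [if_neg (by simp [hjn])]
    symm
    refine Finset.sum_eq_zero fun a _ => Finset.sum_eq_zero fun a' _ => ?_
    rw [if_neg]
    rintro ⟨h1, -, -⟩
    rw [hj] at h1; exact (Fin.castSucc_lt_last a).ne h1.symm
  by_cases hk : ℓ k = Fin.last m
  · have hkn : toOptionLabel ℓ k = none := (toOptionLabel_eq_none_iff ℓ k).2 hk
    rw [if_neg (by simp [hkn])]
    symm
    refine Finset.sum_eq_zero fun a _ => Finset.sum_eq_zero fun a' _ => ?_
    rw [if_neg]
    rintro ⟨-, h2, -⟩
    rw [hk] at h2; exact (Fin.castSucc_lt_last a').ne h2.symm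
  -- both labelled: `ℓ j = cs a₀`, `ℓ k = cs a₀'`
  set a₀ := (ℓ j).castPred hj with ha₀
  set a₀' := (ℓ k).castPred hk with ha₀'
  have hja : ℓ j = a₀.castSucc := by rw [ha₀, Fin.castSucc_castPred]
  have hka : ℓ k = a₀'.castSucc := by rw [ha₀', Fin.castSucc_castPred]
  have hjs : toOptionLabel ℓ j = some a₀ := (toOptionLabel_eq_some_iff ℓ j a₀).2 hja
  have hks : toOptionLabel ℓ k = some a₀' := (toOptionLabel_eq_some_iff ℓ k a₀').2 hka
  rw [Finset.sum_eq_single a₀, Finset.sum_eq_single a₀']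
  · rw [hjs, hks]
    by_cases haa : a₀ = a₀'
    · rw [if_neg (by simp [haa]), if_neg (by simp [haa])]
    · rw [if_pos ⟨by simp [haa], by simp, by simp⟩, if_pos ⟨hja, hka, haa⟩]
  · intro a' _ ha'
    rw [if_neg]
    rintro ⟨-, h2, -⟩
    exact ha' (Fin.castSucc_injective _ (hka.symm.trans h2).symm)
  · intro h; exact absurd (Finset.mem_univ _) h
  · intro a _ ha
    refine Finset.sum_eq_zero fun a' _ => ?_
    rw [if_neg]
    rintro ⟨h1, -, -⟩
    exact ha (Fin.castSucc_injective _ (hja.symm.trans h1).symm)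
  · intro h; exact absurd (Finset.mem_univ _) h

/-- A block Frobenius mass as a double `ite`-sum over all indices. -/
theorem blockMass_eq_sum_ite (ℓ : Fin N → Fin (m + 1)) (X : Matrix (Fin N) (Fin N) ℂ) (a a' : Fin m) :
    ∑ i : {i // ℓ i = a.castSucc}, ∑ j : {j // ℓ j = a'.castSucc},
        ‖X.toBlock (fun i => ℓ i = a.castSucc) (fun j => ℓ j = a'.castSucc) i j‖ ^ 2 =
      ∑ j : Fin N, ∑ k : Fin N, (if ℓ j = a.castSucc ∧ ℓ k = a'.castSucc then ‖X j k‖ ^ 2 else 0) := by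
  classical
  simp only [Matrix.toBlock_apply]
  -- inner sums: subtype → filter → ite
  have hinner : ∀ i : Fin N, ∑ j : {j // ℓ j = a'.castSucc}, ‖X i j‖ ^ 2 =
      ∑ k : Fin N, (if ℓ k = a'.castSucc then ‖X i k‖ ^ 2 else 0) := by
    intro i
    rw [← Finset.sum_filter, ← Finset.sum_subtype (Finset.univ.filter fun k : Fin N => ℓ k = a'.castSucc) (by simp)
      (fun k : Fin N => ‖X i k‖ ^ 2)]
  simp_rw [hinner]
  rw [← Finset.sum_subtype (Finset.univ.filter fun j : Fin N => ℓ j = a.castSucc) (by simp)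
    (fun j : Fin N => ∑ k : Fin N, (if ℓ k = a'.castSucc then ‖X j k‖ ^ 2 else 0)), Finset.sum_filter]
  refine Finset.sum_congr rfl fun j _ => ?_
  split_ifs with hj
  · exact Finset.sum_congr rfl fun k _ => by simp [hj]
  · exact (Finset.sum_eq_zero fun k _ => by simp [hj]).symm

/-- **On the off-block event, w3's off-diagonal mass is at most `m² b`.** -/
theorem offDiagBlockSq_le_of_mem_offBlockEvent (ℓ : Fin N → Fin (m + 1)) {b : ℝ} (hb : 0 ≤ b) {X : UN N}
    (hX : X ∈ offBlockEvent ℓ b) :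
    offDiagBlockSq (toOptionLabel ℓ) (X : Matrix (Fin N) (Fin N) ℂ) ≤ m * m * b := by
  classical
  unfold offDiagBlockSq
  simp_rw [offDiag_indicator_eq_sum ℓ]
  set T : Fin N → Fin N → Fin m → Fin m → ℝ := fun j k a a' =>
    if ℓ j = a.castSucc ∧ ℓ k = a'.castSucc ∧ a ≠ a' then ‖(X : Matrix (Fin N) (Fin N) ℂ) j k‖ ^ 2 else 0 with hT
  have hswap : ∑ j : Fin N, ∑ k : Fin N, ∑ a : Fin m, ∑ a' : Fin m, T j k a a' =
      ∑ a : Fin m, ∑ a' : Fin m, ∑ j : Fin N, ∑ k : Fin N, T j k a a' := by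
    calc ∑ j : Fin N, ∑ k : Fin N, ∑ a : Fin m, ∑ a' : Fin m, T j k a a'
        = ∑ j : Fin N, ∑ a : Fin m, ∑ k : Fin N, ∑ a' : Fin m, T j k a a' :=
          Finset.sum_congr rfl fun j _ => Finset.sum_comm
      _ = ∑ a : Fin m, ∑ j : Fin N, ∑ k : Fin N, ∑ a' : Fin m, T j k a a' := Finset.sum_comm
      _ = ∑ a : Fin m, ∑ j : Fin N, ∑ a' : Fin m, ∑ k : Fin N, T j k a a' :=
          Finset.sum_congr rfl fun a _ => Finset.sum_congr rfl fun j _ => Finset.sum_comm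
      _ = ∑ a : Fin m, ∑ a' : Fin m, ∑ j : Fin N, ∑ k : Fin N, T j k a a' :=
          Finset.sum_congr rfl fun a _ => Finset.sum_comm
  change ∑ j : Fin N, ∑ k : Fin N, ∑ a : Fin m, ∑ a' : Fin m, T j k a a' ≤ _
  rw [hswap]
  calc ∑ a : Fin m, ∑ a' : Fin m, ∑ j : Fin N, ∑ k : Fin N, T j k a a'
      ≤ ∑ a : Fin m, ∑ a' : Fin m, b := by
        refine Finset.sum_le_sum fun a _ => Finset.sum_le_sum fun a' _ => ?_
        by_cases haa : a = a'
        · rw [Finset.sum_eq_zero fun j _ => Finset.sum_eq_zero fun k _ => by simp [hT, haa]]; exact hb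
        · have h := hX a a' haa
          rw [blockMass_eq_sum_ite] at h
          refine le_trans (le_of_eq (Finset.sum_congr rfl fun j _ => Finset.sum_congr rfl fun k _ => ?_)) h
          by_cases h1 : ℓ j = a.castSucc ∧ ℓ k = a'.castSucc
          · simp only [hT]; rw [if_pos ⟨h1.1, h1.2, haa⟩, if_pos h1]
          · simp only [hT]; rw [if_neg (fun h' => h1 ⟨h'.1, h'.2.1⟩), if_neg h1]
    _ = m * m * b := by simp [Finset.sum_const, Finset.card_univ, Fintype.card_fin]; ring

/-- **Haar bound of the off-block event** (w3's off-diagonal-block small-ball theorem). -/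
theorem haar_offBlockEvent_le (m : ℕ) :
    ∃ Cm : ℝ, 0 ≤ Cm ∧ ∀ (N : ℕ) (ℓ : Fin N → Fin (m + 1)) (b : ℝ), 0 ≤ b → 0 < N →
      0 < (m : ℝ) * m * b / N → (m : ℝ) * m * b / N ≤ 1 →
        haarProbability (UN N) (offBlockEvent ℓ b) ≤
          ENNReal.ofReal (Real.exp (Cm * (N : ℝ) ^ 2) *
            ((m : ℝ) * m * b / N) ^ ((labelPairCount (toOptionLabel ℓ) : ℝ) / 2)) := by
  obtain ⟨Cm, hCm, h⟩ := HaarColumns.haar_offDiagBlockSq_smallBall m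
  refine ⟨Cm, hCm, fun N ℓ b hb hN hs hs1 => ?_⟩
  have hsub : offBlockEvent ℓ b ⊆ {W : UN N | offDiagBlockSq (toOptionLabel ℓ) (W : Matrix (Fin N) (Fin N) ℂ) ≤
      N * ((m : ℝ) * m * b / N)} := by
    intro X hX
    simp only [Set.mem_setOf_eq]
    rw [mul_div_cancel₀ _ (by exact_mod_cast hN.ne')]
    exact offDiagBlockSq_le_of_mem_offBlockEvent ℓ hb hX
  exact (measure_mono hsub).trans (h N (toOptionLabel ℓ) _ hs hs1)

end Summit.QuantumFields.YangMills.Theorems.EguchiKawaiDirectionLadder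

end
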